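import Summits.BirchSwinnertonDyer.BirchSwinnertonDyer.Theorems.ManinLocalTwoThreeNoDoublingIVstarFourP
import Summits.BirchSwinnertonDyer.BirchSwinnertonDyer.Theorems.ManinLocalTwoThreeTameTwoIVVeluB
import HarnessLib

/-!
# The doubling profile at `N = 4p`: a doubled class has its `X₀(4p)`-optimal curve of type `IV` (with a rational `2`-torsion
# point) and its `X₁(4p)`-optimal curve of type `IV*` at `2`

Summit `BirchSwinnertonDyer`, route `ManinLocalTwoThree` (cell bsd-f2-manin), deciding crux C2 `ManinOddAtFour`
(stmt-BirchSwinnertonDyer-22967).  Composition of p647003 (`…NoDoublingIVstarFourP`: no doubling on the `IV*` stratum) and p647511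
(`…TameTwoIVVeluB`: on `IV` every globally minimal carrier of the `u = 1` Vélu `2`-pair has `ord₂ Δ_min = 8`) with p3-g6's
`velu_two_of_doubled_four_mul_prime` (doubling ⟹ `W₁` carries the `u = 1` pair of `W₀`):

* `padicValInt_minimalDiscriminantInt_of_doubled_four_mul_prime_of_tame` (modularity-free, `4 ∥ N(W₀)`, `4 ∥ N(W₁)` as hypotheses) and
  `padicValInt_minimalDiscriminantInt_of_doubled_four_mul_prime` (granted `exists_isNewformOf`): at `N = 4p`, `p` an odd prime,
  `|c₀| = 2|c₁|` ⟹ `ord₂ Δ_min(W₀) = 4 ∧ ord₂ Δ_min(W₁) = 8` — the `X₀`-optimal curve is the type-`IV` end, the `X₁`-optimal curve the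
  type-`IV*` end of the `2`-isogeny (MEMO-an §67.7 (c): «doubling sources are exactly optimal `IV*`…» read for the `X₁`-optimal curve;
  «optimal `IV` curves never double» is the POSITION LAW, global, not claimed).
* `natAbs_maninConstant₀_eq_of_padicValInt_ne_four_mul_prime` — contrapositive currency: `ord₂ Δ_min(W₀) ≠ 4 ∨ ord₂ Δ_min(W₁) ≠ 8 ⟹ |c₀| = |c₁|`.

HONEST FRAMING: C2, Manin's conjecture and BSD are not proved.  No definitions, no named facts, no sorry.
References: [CesnaviciusNeururerSaha2023] Lemma 6.5; [SilvermanATAEC1994] IV.9.4 Table 4.1; [DiamondShurman2005] Thm. 8.8.1; HOME/MEMO-an.md §67.7.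
-/

set_option autoImplicit false
set_option linter.dupNamespace false

noncomputable section

open scoped Classical
open WeierstrassCurve Literature.NumberTheory.EllipticCurves Literature.NumberTheory.EllipticCurves.ModularForms
open CongruenceSubgroup Polynomial

namespace Summit.BirchSwinnertonDyer.BirchSwinnertonDyer.Theorems.ManinLocalTwoThree

variable {W₁ W₀ : WeierstrassCurve ℚ} [W₁.IsElliptic] [W₁.IsGloballyMinimal] [W₀.IsElliptic]
  [W₀.IsGloballyMinimal]

/-- **The doubling profile at `4p`, modularity-free form:** `p` odd prime, `(D₁, D₀)` the optimal `X₁(4p)`/`X₀(4p)` pair of a class, both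
curves tame at `2`; if `|c₀| = 2|c₁|` then `ord₂ Δ_min(W₀) = 4` (type `IV`) and `ord₂ Δ_min(W₁) = 8` (type `IV*`).
[cite: CesnaviciusNeururerSaha2023, Lemma 6.5] [cite: SilvermanATAEC1994, IV.9.4 Table 4.1] -/
theorem padicValInt_minimalDiscriminantInt_of_doubled_four_mul_prime_of_tame {p : ℕ} (hp : p.Prime) (hp2 : p ≠ 2)
    [NeZero (4 * p)] (D₁ : Gamma1ParametrizationData W₁ (4 * p)) (D₀ : ModularParametrizationData W₀ (4 * p))
    (hiso : IsIsogenous W₁ W₀) (h₁ : D₁.IsOptimal)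
    (h₀ : ∀ z ∈ D₀.L.lattice, ∃ w ∈ periodLattice D₀.f, z = D₀.c * w)
    (h4₀ : 2 ^ 2 ∣ W₀.conductorNorm ℤ) (h8₀ : ¬ 2 ^ 3 ∣ W₀.conductorNorm ℤ)
    (h4₁ : 2 ^ 2 ∣ W₁.conductorNorm ℤ) (h8₁ : ¬ 2 ^ 3 ∣ W₁.conductorNorm ℤ)
    (hdbl : D₀.maninConstant.natAbs = 2 * D₁.maninConstant.natAbs) :
    padicValInt 2 W₀.minimalDiscriminantInt = 4 ∧ padicValInt 2 W₁.minimalDiscriminantInt = 8 := by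
  have hΔ4 : padicValInt 2 W₀.minimalDiscriminantInt = 4 := by
    rcases padicValInt_minimalDiscriminantInt_eq_four_or_eight_of_tame_two W₀ h4₀ h8₀ with h | h
    · exact h
    · exact absurd hdbl
        (natAbs_maninConstant₀_ne_two_mul_of_IVstar_four_mul_prime_of_tame hp hp2 D₁ D₀ hiso h₁ h₀ h4₀ h8₀ h4₁ h8₁ h)
  obtain ⟨q, hq, hc4, hc6⟩ := velu_two_of_doubled_four_mul_prime hp hp2 D₁ D₀ hiso h₁ h₀ hdbl
  exact ⟨hΔ4, (exists_isGloballyMinimal_velu_two_of_IV W₀ h4₀ h8₀ hΔ4 q hq).2 W₁ hc4 hc6⟩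

/-- **The doubling profile at `N = 4p`** (granted the Modularity Theorem `exists_isNewformOf` for the conductors): `|c₀| = 2|c₁|` ⟹
`ord₂ Δ_min(W₀) = 4 ∧ ord₂ Δ_min(W₁) = 8`. [cite: CesnaviciusNeururerSaha2023, Lemma 6.5] [cite: DiamondShurman2005, Thm. 8.8.1] -/
theorem padicValInt_minimalDiscriminantInt_of_doubled_four_mul_prime (hnf : exists_isNewformOf) {p : ℕ} (hp : p.Prime)
    (hp2 : p ≠ 2) [NeZero (4 * p)] (D₁ : Gamma1ParametrizationData W₁ (4 * p)) (D₀ : ModularParametrizationData W₀ (4 * p))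
    (hiso : IsIsogenous W₁ W₀) (h₁ : D₁.IsOptimal)
    (h₀ : ∀ z ∈ D₀.L.lattice, ∃ w ∈ periodLattice D₀.f, z = D₀.c * w)
    (hdbl : D₀.maninConstant.natAbs = 2 * D₁.maninConstant.natAbs) :
    padicValInt 2 W₀.minimalDiscriminantInt = 4 ∧ padicValInt 2 W₁.minimalDiscriminantInt = 8 := by
  obtain ⟨⟨h4₀, h8₀⟩, ⟨h4₁, h8₁⟩⟩ := four_dvd_not_eight_dvd_conductorNorm_of_level_four_mul_prime hnf hp hp2 D₁ D₀
  exact padicValInt_minimalDiscriminantInt_of_doubled_four_mul_prime_of_tame hp hp2 D₁ D₀ hiso h₁ h₀ h4₀ h8₀ h4₁ h8₁ hdbl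

/-- **`|c₀| = |c₁|` off the doubling profile at `N = 4p`:** if `ord₂ Δ_min(W₀) ≠ 4` or `ord₂ Δ_min(W₁) ≠ 8` then `|c₀| = |c₁|`.
[cite: CesnaviciusNeururerSaha2023, Lemma 6.5] [cite: LingOesterle1991, Thm. 6] -/
theorem natAbs_maninConstant₀_eq_of_padicValInt_ne_four_mul_prime (hnf : exists_isNewformOf) {p : ℕ} (hp : p.Prime)
    (hp2 : p ≠ 2) [NeZero (4 * p)] (D₁ : Gamma1ParametrizationData W₁ (4 * p)) (D₀ : ModularParametrizationData W₀ (4 * p))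
    (hiso : IsIsogenous W₁ W₀) (h₁ : D₁.IsOptimal)
    (h₀ : ∀ z ∈ D₀.L.lattice, ∃ w ∈ periodLattice D₀.f, z = D₀.c * w)
    (hoff : padicValInt 2 W₀.minimalDiscriminantInt ≠ 4 ∨ padicValInt 2 W₁.minimalDiscriminantInt ≠ 8) :
    D₀.maninConstant.natAbs = D₁.maninConstant.natAbs := by
  refine (natAbs_maninConstant₀_eq_or_eq_two_mul_of_four_dvd_level D₁ D₀ hiso h₁ h₀ ⟨p, rfl⟩).resolve_right fun hdbl ↦ ?_
  obtain ⟨h4, h8⟩ := padicValInt_minimalDiscriminantInt_of_doubled_four_mul_prime hnf hp hp2 D₁ D₀ hiso h₁ h₀ hdbl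
  rcases hoff with h | h
  · exact h h4
  · exact h h8

/-- **C2 on the optimal curve ⟺ `2 ∤ c₁`, off the doubling profile at `N = 4p`.** [cite: CesnaviciusNeururerSaha2023, Lemma 6.5] -/
theorem not_two_dvd_maninConstant₀_iff_of_padicValInt_ne_four_mul_prime (hnf : exists_isNewformOf) {p : ℕ} (hp : p.Prime)
    (hp2 : p ≠ 2) [NeZero (4 * p)] (D₁ : Gamma1ParametrizationData W₁ (4 * p)) (D₀ : ModularParametrizationData W₀ (4 * p))
    (hiso : IsIsogenous W₁ W₀) (h₁ : D₁.IsOptimal)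
    (h₀ : ∀ z ∈ D₀.L.lattice, ∃ w ∈ periodLattice D₀.f, z = D₀.c * w)
    (hoff : padicValInt 2 W₀.minimalDiscriminantInt ≠ 4 ∨ padicValInt 2 W₁.minimalDiscriminantInt ≠ 8) :
    ¬ (2 : ℤ) ∣ D₀.maninConstant ↔ ¬ (2 : ℤ) ∣ D₁.maninConstant := by
  have heq := natAbs_maninConstant₀_eq_of_padicValInt_ne_four_mul_prime hnf hp hp2 D₁ D₀ hiso h₁ h₀ hoff
  rw [← Int.natAbs_dvd_natAbs, ← Int.natAbs_dvd_natAbs (b := D₁.maninConstant), heq]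

end Summit.BirchSwinnertonDyer.BirchSwinnertonDyer.Theorems.ManinLocalTwoThree

end
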